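import Mathlib
import Summits.PneNP.PneNP.Theses.OverlapGapAlgebra
import Summits.PneNP.PneNP.Theorems.OverlapGapAlgebraSolvableImpliesStableSectionEtaGeOne
import Summits.PneNP.PneNP.Theorems.OverlapGapAlgebraSolvableImpliesStableSectionConstSection
import Summits.PneNP.PneNP.Theorems.OverlapGapAlgebraSearchHardWindowFromTransfer
import Summits.PneNP.PneNP.Theorems.OverlapGapAlgebraSearchHardWindowCore

/-!
# Child **T** of the regime split of `SolvableImpliesStableSection` implies the summit by itself

Support for item stmt-PneNP-2463 (route OverlapGapAlgebra, crux
`Summit.PneNP.PneNP.Theses.OverlapGapAlgebra.SolvableImpliesStableSection`).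

The strategist's line `RegimeSplit` cuts the crux into three children **G** (f-free sections below
`2^k/k`; proved, `stub_lowDensity`), **M** (f-free sections on `[2^k/k, 2^k log k/k)`) and **T** (the
crux verbatim on the core `2^k log k/k ≤ α < 2^k log 2`, `η < 1`, `ν ≤ 2^{-k}`), with the tree glue
`sissS_solvableImpliesStableSection_of_split : G → M → T → crux` and
`sissS_core_of_solvableImpliesStableSection : crux → T`.

This file certifies that **T alone is summit-strength**: the Bresler–Huang window density
`α_k = 5·2^k log k/k` lies in T's strip for every `k ≥ 400` (`sissT_window_density_lt_log_two`), the
side conditions `η < 1`, `ν ≤ 2^{-k}` of T are exactly the complement of two landed regimes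
(`solvableImpliesStableSection_of_eta_ge_one`, `solvableImpliesStableSection_of_nu_gt`), so T gives the
window form of the transfer (`sissT_windowTransfer_of_core`), hence `SearchHardWindow`
(`searchHardWindow_of_windowTransfer'`, which uses the proved crux `NoStableSection`) and `PneNP`
(`searchHardWindow_implies_pneNP`):

* `sissT_searchHardWindow_of_core : T → SearchHardWindow`,
* `sissT_pneNP_of_core : T → PneNP`.

Consequence for the route's bookkeeping: filing child T is filing (a statement at least as strong as)
the summit; with G proved, the crux is `M ∧ T` up to landed glue, `M` being f-free random-CSP geometry.
No new definitions; axioms `propext`, `Classical.choice`, `Quot.sound`.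
-/

set_option linter.dupNamespace false -- `Summit.PneNP.PneNP.…`: summit = sub-problem (D-0017)

namespace Summit.PneNP.PneNP.Theorems

open Finset
open Summit.PneNP.PneNP.Theses.OverlapGapAlgebra

/-- For `k ≥ 400`, `log k ≤ k/10` (via `log √k ≤ √k - 1` and `20 ≤ √k`). -/
theorem sissT_log_le_div_ten (k : ℕ) (hk : 400 ≤ k) : Real.log k ≤ (k : ℝ) / 10 := by
  have hk' : (400 : ℝ) ≤ k := by exact_mod_cast hk
  have hk0 : (0 : ℝ) ≤ k := by positivity
  have hs20 : (20 : ℝ) ≤ Real.sqrt k := by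
    have h400 : Real.sqrt (400 : ℝ) = 20 := by
      rw [show (400 : ℝ) = 20 ^ 2 by norm_num, Real.sqrt_sq (by norm_num)]
    rw [← h400]
    exact Real.sqrt_le_sqrt hk'
  have hspos : 0 < Real.sqrt k := by linarith
  have hlog : Real.log k = 2 * Real.log (Real.sqrt k) := by
    rw [Real.log_sqrt hk0]; ring
  have h1 : Real.log (Real.sqrt k) ≤ Real.sqrt k - 1 := Real.log_le_sub_one_of_pos hspos
  have h2 : Real.sqrt k * Real.sqrt k = k := Real.mul_self_sqrt hk0
  have h3 : 20 * Real.sqrt k ≤ k := by nlinarith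
  rw [hlog]
  nlinarith

/-- For `k ≥ 400` the Bresler–Huang window density `5·2^k log k/k` is below `2^k log 2`
(indeed `5 log k/k ≤ 1/2 < log 2`). -/
theorem sissT_window_density_lt_log_two (k : ℕ) (hk : 400 ≤ k) :
    5 * 2 ^ k * Real.log k / k < (2 : ℝ) ^ k * Real.log 2 := by
  have hkpos : (0 : ℝ) < k := by exact_mod_cast (show 0 < k by omega)
  have hlog := sissT_log_le_div_ten k hk
  have hlog2 : (1 / 2 : ℝ) < Real.log 2 := by
    have := Real.log_two_gt_d9
    linarith
  have h2k : (0 : ℝ) < 2 ^ k := by positivity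
  calc 5 * 2 ^ k * Real.log k / k ≤ 5 * 2 ^ k * ((k : ℝ) / 10) / k := by gcongr
    _ = 2 ^ k * (1 / 2) := by field_simp; ring
    _ < 2 ^ k * Real.log 2 := by gcongr

/-- For `k ≥ 2` the window density `5·2^k log k/k` is at least the lower edge `2^k log k/k` of T's strip. -/
theorem sissT_core_lower_le_window_density (k : ℕ) (hk : 2 ≤ k) :
    (2 : ℝ) ^ k * Real.log k / k ≤ 5 * 2 ^ k * Real.log k / k := by
  have hkpos : (0 : ℝ) < k := by exact_mod_cast (show 0 < k by omega)
  have hlogk : 0 ≤ Real.log k := Real.log_nonneg (by exact_mod_cast (show 1 ≤ k by omega))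
  have h0 : 0 ≤ (2 : ℝ) ^ k * Real.log k / k := by positivity
  have : 5 * (2 : ℝ) ^ k * Real.log k / k = 5 * ((2 : ℝ) ^ k * Real.log k / k) := by ring
  rw [this]
  nlinarith

/-- **The large-`k` tail of child T already gives the window form of the transfer.**  If the crux
holds on its core (`2^k log k/k ≤ α < 2^k log 2`, `0 < η < 1`, `0 < ν ≤ 2^{-k}`) for every `k ≥ 400`,
then for every `k ≥ 400`, at the window density `α_k = 5·2^k log k/k` and for ALL `η, ν > 0`,
polynomial-time solvability with probability `≥ ε` infinitely often gives, for every `c > 0`, stable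
sections on `≥ e^{-cn}` of the path tuples infinitely often (the cases `η ≥ 1`, `ν > 2^{-k}` being
landed theorems, `solvableImpliesStableSection_of_eta_ge_one` / `solvableImpliesStableSection_of_nu_gt`). -/
theorem sissT_windowTransfer_of_core_tail
    (hT : ∀ k : ℕ, 400 ≤ k → ∀ α η ν : ℝ, 2 ^ k * Real.log k / k ≤ α → α < 2 ^ k * Real.log 2 →
      0 < η → η < 1 → 0 < ν → ν ≤ (1 / 2 : ℝ) ^ k →
      (∃ f : List Bool → List Bool, Literature.Computability.Complexity.IsPolyTime f ∧
        ∃ ε : ℝ, 0 < ε ∧ ∃ᶠ n : ℕ in Filter.atTop, ∀ m : ℕ, m = ⌊α * n⌋₊ → ε ≤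
          ((Finset.univ.filter fun Φ : Fin m → Fin k → Fin n × Bool => ∀ i, ∃ j,
            (f (Literature.Computability.Complexity.encodingCNF.encode (List.ofFn fun a =>
              List.ofFn fun b => (((Φ a b).1 : ℕ), (Φ a b).2)))).getD (Φ i j).1 false =
                (Φ i j).2).card : ℝ) / Fintype.card (Fin m → Fin k → Fin n × Bool)) →
      ∀ c : ℝ, 0 < c → ∃ᶠ n : ℕ in Filter.atTop, ∀ m : ℕ, m = ⌊α * n⌋₊ →
        ∃ g : (Fin m → Fin k → Fin n × Bool) → (Fin n → Bool),
          Real.exp (-(c * n)) * Fintype.card (Fin (k + 1) → Fin m → Fin k → Fin n × Bool) ≤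
          ((Finset.univ.filter fun Ψ : Fin (k + 1) → Fin m → Fin k → Fin n × Bool =>
            let P : Fin k → ℕ → Fin m → Fin k → Fin n × Bool :=
              fun r q a b => if (a : ℕ) * k + b < q then Ψ r.succ a b else Ψ r.castSucc a b
            (∀ r : Fin k, ∀ q ≤ m * k, ((Finset.univ.filter fun i : Fin m =>
              ∀ j, g (P r q) (P r q i j).1 ≠ (P r q i j).2).card : ℝ) ≤ ν * m) ∧
            ∀ r : Fin k, ∀ q < m * k,
              (hammingDist (g (P r q)) (g (P r (q + 1))) : ℝ) ≤ η * n).card : ℝ)) :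
    ∃ k₁ : ℕ, ∀ k : ℕ, k₁ ≤ k → ∀ η ν : ℝ, 0 < η → 0 < ν →
      (∃ f : List Bool → List Bool, Literature.Computability.Complexity.IsPolyTime f ∧ ∃ ε : ℝ, 0 < ε ∧
        ∃ᶠ n : ℕ in Filter.atTop, ∀ m : ℕ, m = ⌊5 * 2 ^ k * Real.log k / k * n⌋₊ → ε ≤
          ((Finset.univ.filter fun Φ : Fin m → Fin k → Fin n × Bool => ∀ i, ∃ j,
            (f (Literature.Computability.Complexity.encodingCNF.encode (List.ofFn fun a =>
              List.ofFn fun b => (((Φ a b).1 : ℕ), (Φ a b).2)))).getD (Φ i j).1 false =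
                (Φ i j).2).card : ℝ) / Fintype.card (Fin m → Fin k → Fin n × Bool)) →
      ∀ c : ℝ, 0 < c → ∃ᶠ n : ℕ in Filter.atTop, ∀ m : ℕ, m = ⌊5 * 2 ^ k * Real.log k / k * n⌋₊ →
        ∃ g : (Fin m → Fin k → Fin n × Bool) → (Fin n → Bool),
          Real.exp (-(c * n)) * Fintype.card (Fin (k + 1) → Fin m → Fin k → Fin n × Bool) ≤
          ((Finset.univ.filter fun Ψ : Fin (k + 1) → Fin m → Fin k → Fin n × Bool =>
            let P : Fin k → ℕ → Fin m → Fin k → Fin n × Bool :=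
              fun r q a b => if (a : ℕ) * k + b < q then Ψ r.succ a b else Ψ r.castSucc a b
            (∀ r : Fin k, ∀ q ≤ m * k, ((Finset.univ.filter fun i : Fin m =>
              ∀ j, g (P r q) (P r q i j).1 ≠ (P r q i j).2).card : ℝ) ≤ ν * m) ∧
            ∀ r : Fin k, ∀ q < m * k,
              (hammingDist (g (P r q)) (g (P r (q + 1))) : ℝ) ≤ η * n).card : ℝ) := by
  refine ⟨400, fun k hk η ν hη hν hsolv c hc => ?_⟩
  have hk1 : 1 ≤ k := by omega
  have hkpos : (0 : ℝ) < k := by exact_mod_cast (show 0 < k by omega)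
  have hlogk : 0 < Real.log k := Real.log_pos (by exact_mod_cast (show 1 < k by omega))
  have hα : 0 < 5 * 2 ^ k * Real.log k / k := by positivity
  by_cases hη1 : 1 ≤ η
  · obtain ⟨f, -, ε, hε, hfreq⟩ := hsolv
    exact Summit.PneNP.PneNP.Cruxes.SolvableImpliesStableSection.Sketch.solvableImpliesStableSection_of_eta_ge_one
      k hk1 _ η ν hα hη1 hν ⟨f, ε, hε, hfreq⟩ c hc
  by_cases hνk : (1 / 2 : ℝ) ^ k < ν
  · exact Summit.PneNP.PneNP.Cruxes.SolvableImpliesStableSection.Sketch.solvableImpliesStableSection_of_nu_gt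
      k hk1 _ η ν hα hη hνk c hc
  exact hT k hk _ η ν (sissT_core_lower_le_window_density k (by omega))
    (sissT_window_density_lt_log_two k hk) hη (not_le.mp hη1) hν (not_lt.mp hνk) hsolv c hc

/-- **The large-`k` tail of child T implies the summit**: T for `k ≥ 400` only (at `η < 1`,
`ν ≤ 2^{-k}`) gives `SearchHardWindow` (`searchHardWindow_of_windowTransfer'`, which uses the proved
crux `NoStableSection`) and hence `PneNP` (`searchHardWindow_implies_pneNP`).  So every restatement of
the crux that keeps a large-`k` tail of the core strip at small `η, ν` is still summit-strength. -/
theorem sissT_pneNP_of_core_tail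
    (hT : ∀ k : ℕ, 400 ≤ k → ∀ α η ν : ℝ, 2 ^ k * Real.log k / k ≤ α → α < 2 ^ k * Real.log 2 →
      0 < η → η < 1 → 0 < ν → ν ≤ (1 / 2 : ℝ) ^ k →
      (∃ f : List Bool → List Bool, Literature.Computability.Complexity.IsPolyTime f ∧
        ∃ ε : ℝ, 0 < ε ∧ ∃ᶠ n : ℕ in Filter.atTop, ∀ m : ℕ, m = ⌊α * n⌋₊ → ε ≤
          ((Finset.univ.filter fun Φ : Fin m → Fin k → Fin n × Bool => ∀ i, ∃ j,
            (f (Literature.Computability.Complexity.encodingCNF.encode (List.ofFn fun a =>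
              List.ofFn fun b => (((Φ a b).1 : ℕ), (Φ a b).2)))).getD (Φ i j).1 false =
                (Φ i j).2).card : ℝ) / Fintype.card (Fin m → Fin k → Fin n × Bool)) →
      ∀ c : ℝ, 0 < c → ∃ᶠ n : ℕ in Filter.atTop, ∀ m : ℕ, m = ⌊α * n⌋₊ →
        ∃ g : (Fin m → Fin k → Fin n × Bool) → (Fin n → Bool),
          Real.exp (-(c * n)) * Fintype.card (Fin (k + 1) → Fin m → Fin k → Fin n × Bool) ≤
          ((Finset.univ.filter fun Ψ : Fin (k + 1) → Fin m → Fin k → Fin n × Bool =>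
            let P : Fin k → ℕ → Fin m → Fin k → Fin n × Bool :=
              fun r q a b => if (a : ℕ) * k + b < q then Ψ r.succ a b else Ψ r.castSucc a b
            (∀ r : Fin k, ∀ q ≤ m * k, ((Finset.univ.filter fun i : Fin m =>
              ∀ j, g (P r q) (P r q i j).1 ≠ (P r q i j).2).card : ℝ) ≤ ν * m) ∧
            ∀ r : Fin k, ∀ q < m * k,
              (hammingDist (g (P r q)) (g (P r (q + 1))) : ℝ) ≤ η * n).card : ℝ)) :
    _root_.PneNP :=
  searchHardWindow_implies_pneNP (searchHardWindow_of_windowTransfer' (sissT_windowTransfer_of_core_tail hT))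

/-- **Child T gives the window form of the transfer** (T as registered: every `k ≥ 3`). -/
theorem sissT_windowTransfer_of_core
    (hT : ∀ k : ℕ, 3 ≤ k → ∀ α η ν : ℝ, 2 ^ k * Real.log k / k ≤ α → α < 2 ^ k * Real.log 2 →
      0 < η → η < 1 → 0 < ν → ν ≤ (1 / 2 : ℝ) ^ k →
      (∃ f : List Bool → List Bool, Literature.Computability.Complexity.IsPolyTime f ∧
        ∃ ε : ℝ, 0 < ε ∧ ∃ᶠ n : ℕ in Filter.atTop, ∀ m : ℕ, m = ⌊α * n⌋₊ → ε ≤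
          ((Finset.univ.filter fun Φ : Fin m → Fin k → Fin n × Bool => ∀ i, ∃ j,
            (f (Literature.Computability.Complexity.encodingCNF.encode (List.ofFn fun a =>
              List.ofFn fun b => (((Φ a b).1 : ℕ), (Φ a b).2)))).getD (Φ i j).1 false =
                (Φ i j).2).card : ℝ) / Fintype.card (Fin m → Fin k → Fin n × Bool)) →
      ∀ c : ℝ, 0 < c → ∃ᶠ n : ℕ in Filter.atTop, ∀ m : ℕ, m = ⌊α * n⌋₊ →
        ∃ g : (Fin m → Fin k → Fin n × Bool) → (Fin n → Bool),
          Real.exp (-(c * n)) * Fintype.card (Fin (k + 1) → Fin m → Fin k → Fin n × Bool) ≤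
          ((Finset.univ.filter fun Ψ : Fin (k + 1) → Fin m → Fin k → Fin n × Bool =>
            let P : Fin k → ℕ → Fin m → Fin k → Fin n × Bool :=
              fun r q a b => if (a : ℕ) * k + b < q then Ψ r.succ a b else Ψ r.castSucc a b
            (∀ r : Fin k, ∀ q ≤ m * k, ((Finset.univ.filter fun i : Fin m =>
              ∀ j, g (P r q) (P r q i j).1 ≠ (P r q i j).2).card : ℝ) ≤ ν * m) ∧
            ∀ r : Fin k, ∀ q < m * k,
              (hammingDist (g (P r q)) (g (P r (q + 1))) : ℝ) ≤ η * n).card : ℝ)) :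
    ∃ k₁ : ℕ, ∀ k : ℕ, k₁ ≤ k → ∀ η ν : ℝ, 0 < η → 0 < ν →
      (∃ f : List Bool → List Bool, Literature.Computability.Complexity.IsPolyTime f ∧ ∃ ε : ℝ, 0 < ε ∧
        ∃ᶠ n : ℕ in Filter.atTop, ∀ m : ℕ, m = ⌊5 * 2 ^ k * Real.log k / k * n⌋₊ → ε ≤
          ((Finset.univ.filter fun Φ : Fin m → Fin k → Fin n × Bool => ∀ i, ∃ j,
            (f (Literature.Computability.Complexity.encodingCNF.encode (List.ofFn fun a =>
              List.ofFn fun b => (((Φ a b).1 : ℕ), (Φ a b).2)))).getD (Φ i j).1 false =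
                (Φ i j).2).card : ℝ) / Fintype.card (Fin m → Fin k → Fin n × Bool)) →
      ∀ c : ℝ, 0 < c → ∃ᶠ n : ℕ in Filter.atTop, ∀ m : ℕ, m = ⌊5 * 2 ^ k * Real.log k / k * n⌋₊ →
        ∃ g : (Fin m → Fin k → Fin n × Bool) → (Fin n → Bool),
          Real.exp (-(c * n)) * Fintype.card (Fin (k + 1) → Fin m → Fin k → Fin n × Bool) ≤
          ((Finset.univ.filter fun Ψ : Fin (k + 1) → Fin m → Fin k → Fin n × Bool =>
            let P : Fin k → ℕ → Fin m → Fin k → Fin n × Bool :=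
              fun r q a b => if (a : ℕ) * k + b < q then Ψ r.succ a b else Ψ r.castSucc a b
            (∀ r : Fin k, ∀ q ≤ m * k, ((Finset.univ.filter fun i : Fin m =>
              ∀ j, g (P r q) (P r q i j).1 ≠ (P r q i j).2).card : ℝ) ≤ ν * m) ∧
            ∀ r : Fin k, ∀ q < m * k,
              (hammingDist (g (P r q)) (g (P r (q + 1))) : ℝ) ≤ η * n).card : ℝ) :=
  sissT_windowTransfer_of_core_tail fun k hk => hT k (le_trans (by norm_num) hk)

/-- **Child T gives `SearchHardWindow`** (stmt-PneNP-2460): the window form of the transfer from T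
(`sissT_windowTransfer_of_core`) and the proved crux `NoStableSection` (`searchHardWindow_of_windowTransfer'`). -/
theorem sissT_searchHardWindow_of_core
    (hT : ∀ k : ℕ, 3 ≤ k → ∀ α η ν : ℝ, 2 ^ k * Real.log k / k ≤ α → α < 2 ^ k * Real.log 2 →
      0 < η → η < 1 → 0 < ν → ν ≤ (1 / 2 : ℝ) ^ k →
      (∃ f : List Bool → List Bool, Literature.Computability.Complexity.IsPolyTime f ∧
        ∃ ε : ℝ, 0 < ε ∧ ∃ᶠ n : ℕ in Filter.atTop, ∀ m : ℕ, m = ⌊α * n⌋₊ → ε ≤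
          ((Finset.univ.filter fun Φ : Fin m → Fin k → Fin n × Bool => ∀ i, ∃ j,
            (f (Literature.Computability.Complexity.encodingCNF.encode (List.ofFn fun a =>
              List.ofFn fun b => (((Φ a b).1 : ℕ), (Φ a b).2)))).getD (Φ i j).1 false =
                (Φ i j).2).card : ℝ) / Fintype.card (Fin m → Fin k → Fin n × Bool)) →
      ∀ c : ℝ, 0 < c → ∃ᶠ n : ℕ in Filter.atTop, ∀ m : ℕ, m = ⌊α * n⌋₊ →
        ∃ g : (Fin m → Fin k → Fin n × Bool) → (Fin n → Bool),
          Real.exp (-(c * n)) * Fintype.card (Fin (k + 1) → Fin m → Fin k → Fin n × Bool) ≤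
          ((Finset.univ.filter fun Ψ : Fin (k + 1) → Fin m → Fin k → Fin n × Bool =>
            let P : Fin k → ℕ → Fin m → Fin k → Fin n × Bool :=
              fun r q a b => if (a : ℕ) * k + b < q then Ψ r.succ a b else Ψ r.castSucc a b
            (∀ r : Fin k, ∀ q ≤ m * k, ((Finset.univ.filter fun i : Fin m =>
              ∀ j, g (P r q) (P r q i j).1 ≠ (P r q i j).2).card : ℝ) ≤ ν * m) ∧
            ∀ r : Fin k, ∀ q < m * k,
              (hammingDist (g (P r q)) (g (P r (q + 1))) : ℝ) ≤ η * n).card : ℝ)) :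
    SearchHardWindow :=
  searchHardWindow_of_windowTransfer' (sissT_windowTransfer_of_core hT)

/-- **Child T implies the summit.**  The restriction of `SolvableImpliesStableSection` to its core
(`2^k log k/k ≤ α < 2^k log 2`, `η < 1`, `ν ≤ 2^{-k}`, every `k ≥ 3` — child T of line `RegimeSplit`,
verbatim the hypothesis `hT` of `sissS_solvableImpliesStableSection_of_split`) already implies `P ≠ NP`.
Together with `sissS_core_of_solvableImpliesStableSection : crux → T` this certifies that child T is
exactly as strong as the crux on the summit: each implies `PneNP` on its own. -/
theorem sissT_pneNP_of_core
    (hT : ∀ k : ℕ, 3 ≤ k → ∀ α η ν : ℝ, 2 ^ k * Real.log k / k ≤ α → α < 2 ^ k * Real.log 2 →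
      0 < η → η < 1 → 0 < ν → ν ≤ (1 / 2 : ℝ) ^ k →
      (∃ f : List Bool → List Bool, Literature.Computability.Complexity.IsPolyTime f ∧
        ∃ ε : ℝ, 0 < ε ∧ ∃ᶠ n : ℕ in Filter.atTop, ∀ m : ℕ, m = ⌊α * n⌋₊ → ε ≤
          ((Finset.univ.filter fun Φ : Fin m → Fin k → Fin n × Bool => ∀ i, ∃ j,
            (f (Literature.Computability.Complexity.encodingCNF.encode (List.ofFn fun a =>
              List.ofFn fun b => (((Φ a b).1 : ℕ), (Φ a b).2)))).getD (Φ i j).1 false =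
                (Φ i j).2).card : ℝ) / Fintype.card (Fin m → Fin k → Fin n × Bool)) →
      ∀ c : ℝ, 0 < c → ∃ᶠ n : ℕ in Filter.atTop, ∀ m : ℕ, m = ⌊α * n⌋₊ →
        ∃ g : (Fin m → Fin k → Fin n × Bool) → (Fin n → Bool),
          Real.exp (-(c * n)) * Fintype.card (Fin (k + 1) → Fin m → Fin k → Fin n × Bool) ≤
          ((Finset.univ.filter fun Ψ : Fin (k + 1) → Fin m → Fin k → Fin n × Bool =>
            let P : Fin k → ℕ → Fin m → Fin k → Fin n × Bool :=
              fun r q a b => if (a : ℕ) * k + b < q then Ψ r.succ a b else Ψ r.castSucc a b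
            (∀ r : Fin k, ∀ q ≤ m * k, ((Finset.univ.filter fun i : Fin m =>
              ∀ j, g (P r q) (P r q i j).1 ≠ (P r q i j).2).card : ℝ) ≤ ν * m) ∧
            ∀ r : Fin k, ∀ q < m * k,
              (hammingDist (g (P r q)) (g (P r (q + 1))) : ℝ) ≤ η * n).card : ℝ)) :
    _root_.PneNP :=
  searchHardWindow_implies_pneNP (sissT_searchHardWindow_of_core hT)

end Summit.PneNP.PneNP.Theorems
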